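import Mathlib.Analysis.Calculus.ContDiff.Basic
import Mathlib.Analysis.Calculus.IteratedDeriv.Lemmas
import Mathlib.Analysis.Calculus.Deriv.Prod
import HarnessLib

/-!
# Nested partial derivatives of a space-time field versus its joint derivatives

Analysis/FunctionSpaces support file (everything proved). For a field `w : ℝ × E → F` of class
`C^{k+l}` on an open set `U ∋ (t, x)`, the nested partial derivative "`∇ₓᵏ ∂ₜˡ w`" — in Lean,
`iteratedFDeriv ℝ k (fun y => iteratedDeriv l (fun τ => w (τ, y)) t) x`, the form used in the
statement of Koch–Nadirashvili–Seregin–Šverák 2009, Prop. 4.1 (`knss2009_smoothing`) — is a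
restriction of the joint derivative `D^{k+l} w (t, x)` to the vectors `(0, h₁), …, (0, h_k),
(1, 0), …, (1, 0)`, whence

* `norm_iteratedFDeriv_slice_iteratedDeriv_le`:
  `‖∇ₓᵏ ∂ₜˡ w (t, x)‖ ≤ ‖D^{k+l} w (t, x)‖` (and the `uncurry` form
  `norm_iteratedFDeriv_iteratedDeriv_le_uncurry` for `v : ℝ → E → F`).

The proof goes through the `l`-fold time derivative `∂ₜˡ w = (q ↦ Dw(q)(1, 0))^{∘ l}`
(`iteratedDeriv_slice_eq_iterate`: the time slices of `w` have `iteratedDeriv l = ∂ₜˡ w`;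
`norm_iteratedFDeriv_iterate_le`: `‖D^k ∂ₜˡ w‖ ≤ ‖D^{k+l} w‖`, from `norm_iteratedFDeriv_fderiv`)
and the chain rule for the space slices `y ↦ W (t, y)` (`iteratedFDeriv_slice_apply`).
Standard multivariable calculus (Dieudonné, *Foundations of Modern Analysis*, (8.9), (8.12)).

## References

* J. Dieudonné, *Foundations of Modern Analysis* (1960), (8.9.2), (8.12.1)–(8.12.8). [folklore]
-/

noncomputable section

open Set Filter Topology Function

namespace Literature.Analysis.FunctionSpaces

variable {E : Type*} [NormedAddCommGroup E] [NormedSpace ℝ E]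
  {F : Type*} [NormedAddCommGroup F] [NormedSpace ℝ F]
  {U : Set (ℝ × E)}

/-- A directional derivative `q ↦ Dw(q) e` of a `C^{n+1}` field on an open set is `Cⁿ` there.
[folklore] -/
theorem contDiffOn_fderiv_apply_of_isOpen (hU : IsOpen U) {n : ℕ} {w : ℝ × E → F}
    (hw : ContDiffOn ℝ (n + 1 : ℕ) w U) (e : ℝ × E) :
    ContDiffOn ℝ n (fun q => fderiv ℝ w q e) U :=
  (hw.fderiv_of_isOpen hU (by exact_mod_cast le_refl (n + 1))).clm_apply contDiffOn_const

/-- The `l`-fold directional derivative `(q ↦ Dw(q) e)^{∘ l}` of a `C^{k+l}` field on an open set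
is `Cᵏ` there. [folklore] -/
theorem contDiffOn_iterate_fderiv_apply (hU : IsOpen U) (e : ℝ × E) (k l : ℕ) {w : ℝ × E → F}
    (hw : ContDiffOn ℝ (k + l : ℕ) w U) :
    ContDiffOn ℝ k ((fun (w : ℝ × E → F) (q : ℝ × E) => fderiv ℝ w q e)^[l] w) U := by
  induction l generalizing w with
  | zero => simpa using hw
  | succ l IH =>
    rw [Function.iterate_succ_apply]
    have hw' : ContDiffOn ℝ (k + l + 1 : ℕ) w U := hw
    exact IH (contDiffOn_fderiv_apply_of_isOpen hU hw' e)

/-- **Time slices**: for a `Cˡ` field `w` on an open set `U` and `(t, y) ∈ U`, the `l`-th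
derivative of the time slice `τ ↦ w (τ, y)` at `t` is the `l`-fold time derivative
`∂ₜˡ w (t, y) = ((q ↦ Dw(q)(1, 0))^{∘ l} w)(t, y)`. [folklore] -/
theorem iteratedDeriv_slice_eq_iterate (hU : IsOpen U) {t : ℝ} (l : ℕ) {w : ℝ × E → F}
    (hw : ContDiffOn ℝ l w U) {y : E} (hy : (t, y) ∈ U) :
    iteratedDeriv l (fun τ => w (τ, y)) t =
      ((fun (w : ℝ × E → F) (q : ℝ × E) => fderiv ℝ w q (1, 0))^[l] w) (t, y) := by
  induction l generalizing w with
  | zero => simp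
  | succ l IH =>
    rw [iteratedDeriv_succ', Function.iterate_succ_apply]
    have hdiff : DifferentiableOn ℝ w U := hw.differentiableOn (by exact_mod_cast Nat.succ_ne_zero l)
    -- the derivative of the time slice is the time derivative of `w`, near `t`
    have hev : deriv (fun τ => w (τ, y)) =ᶠ[𝓝 t] fun τ => fderiv ℝ w (τ, y) (1, 0) := by
      have hopen : IsOpen {τ : ℝ | (τ, y) ∈ U} := hU.preimage (continuous_id.prodMk continuous_const)
      filter_upwards [hopen.mem_nhds hy] with τ hτ
      have h1 : HasFDerivAt w (fderiv ℝ w (τ, y)) (τ, y) :=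
        (hdiff.differentiableAt (hU.mem_nhds hτ)).hasFDerivAt
      have h2 : HasDerivAt (fun τ' : ℝ => (τ', y)) ((1 : ℝ), (0 : E)) τ :=
        (hasDerivAt_id' τ).prodMk (hasDerivAt_const τ y)
      exact (h1.comp_hasDerivAt τ h2).deriv
    rw [hev.iteratedDeriv_eq]
    have hw' : ContDiffOn ℝ (l + 1 : ℕ) w U := hw
    exact IH (contDiffOn_fderiv_apply_of_isOpen hU hw' (1, 0))

/-- **Space slices**: for a `Cᵏ` field `W` on an open set `U ∋ (t, x)`, the `k`-th derivative of
the space slice `y ↦ W (t, y)` at `x` is the joint derivative on the vectors `(0, hᵢ)`: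
`D^k (W(t, ·))(x)[h₁, …, h_k] = D^k W (t, x)[(0, h₁), …, (0, h_k)]` (chain rule for the affine
map `y ↦ (t, y)`). [folklore] -/
theorem iteratedFDeriv_slice_apply (hU : IsOpen U) {k : ℕ} {W : ℝ × E → F} (hW : ContDiffOn ℝ k W U)
    {t : ℝ} {x : E} (hp : (t, x) ∈ U) (H : Fin k → E) :
    iteratedFDeriv ℝ k (fun y => W (t, y)) x H =
      iteratedFDeriv ℝ k W (t, x) (fun i => ((0 : ℝ), H i)) := by
  set U' : Set (ℝ × E) := (fun q => q + ((t, 0) : ℝ × E)) ⁻¹' U with hU'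
  have hU'o : IsOpen U' := hU.preimage (continuous_id.add continuous_const)
  have hW' : ContDiffOn ℝ k (fun q : ℝ × E => W (q + (t, 0))) U' :=
    hW.comp (contDiffOn_id.add contDiffOn_const) fun q hq => hq
  set L : E →L[ℝ] ℝ × E := ContinuousLinearMap.inr ℝ ℝ E with hL
  have hLx : L x + ((t, 0) : ℝ × E) = (t, x) := by simp [hL]
  have hxU' : L x ∈ U' := by
    show L x + ((t, 0) : ℝ × E) ∈ U
    rw [hLx]; exact hp
  have hpre : IsOpen (L ⁻¹' U') := hU'o.preimage L.continuous
  have hchain := ContinuousLinearMap.iteratedFDerivWithin_comp_right L hW' hU'o.uniqueDiffOn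
    hpre.uniqueDiffOn hxU' (i := k) le_rfl
  rw [iteratedFDerivWithin_of_isOpen k hpre hxU', iteratedFDerivWithin_of_isOpen k hU'o hxU',
    iteratedFDeriv_comp_add_right k, hLx] at hchain
  have hfun : (fun y => W (t, y)) = (fun q : ℝ × E => W (q + (t, 0))) ∘ L := by
    funext y; simp [hL]
  rw [hfun, hchain, ContinuousMultilinearMap.compContinuousLinearMap_apply]
  simp [hL]

/-- One time derivative costs one joint derivative:
`‖Dⁿ (q ↦ Dw(q) e)(p)‖ ≤ ‖D^{n+1} w (p)‖` for `‖e‖ ≤ 1`. [folklore] -/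
theorem norm_iteratedFDeriv_fderiv_apply_le {n : ℕ} {w : ℝ × E → F} {p : ℝ × E}
    (hw : ContDiffAt ℝ (n + 1 : ℕ) w p) {e : ℝ × E} (he : ‖e‖ ≤ 1) :
    ‖iteratedFDeriv ℝ n (fun q => fderiv ℝ w q e) p‖ ≤ ‖iteratedFDeriv ℝ (n + 1) w p‖ := by
  have hfd : ContDiffAt ℝ n (fderiv ℝ w) p := hw.fderiv_right (by exact_mod_cast le_refl (n + 1))
  have hcomp : (fun q => fderiv ℝ w q e) = (ContinuousLinearMap.apply ℝ F e) ∘ fderiv ℝ w := rfl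
  rw [hcomp, ContinuousLinearMap.iteratedFDeriv_comp_left _ hfd le_rfl, ← norm_iteratedFDeriv_fderiv]
  refine ContinuousMultilinearMap.opNorm_le_bound (norm_nonneg _) fun m => ?_
  rw [ContinuousLinearMap.compContinuousMultilinearMap_coe, comp_apply, ContinuousLinearMap.apply_apply]
  calc ‖iteratedFDeriv ℝ n (fderiv ℝ w) p m e‖
      ≤ ‖iteratedFDeriv ℝ n (fderiv ℝ w) p m‖ * ‖e‖ := ContinuousLinearMap.le_opNorm _ _
    _ ≤ (‖iteratedFDeriv ℝ n (fderiv ℝ w) p‖ * ∏ i, ‖m i‖) * 1 :=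
        mul_le_mul (ContinuousMultilinearMap.le_opNorm _ _) he (norm_nonneg _) (by positivity)
    _ = ‖iteratedFDeriv ℝ n (fderiv ℝ w) p‖ * ∏ i, ‖m i‖ := mul_one _

/-- **`l` time derivatives cost `l` joint derivatives**: `‖Dᵏ ∂ₜˡ w (p)‖ ≤ ‖D^{k+l} w (p)‖` for a
`C^{k+l}` field on an open set `U ∋ p`. [folklore] -/
theorem norm_iteratedFDeriv_iterate_le (hU : IsOpen U) (k l : ℕ) {w : ℝ × E → F}
    (hw : ContDiffOn ℝ (k + l : ℕ) w U) {p : ℝ × E} (hp : p ∈ U) :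
    ‖iteratedFDeriv ℝ k ((fun (w : ℝ × E → F) (q : ℝ × E) => fderiv ℝ w q (1, 0))^[l] w) p‖ ≤
      ‖iteratedFDeriv ℝ (k + l) w p‖ := by
  induction l generalizing w with
  | zero => simp
  | succ l IH =>
    rw [Function.iterate_succ_apply]
    have hw' : ContDiffOn ℝ (k + l + 1 : ℕ) w U := hw
    refine (IH (contDiffOn_fderiv_apply_of_isOpen hU hw' (1, 0))).trans ?_
    have h1 : ‖((1 : ℝ), (0 : E))‖ ≤ 1 := by simp [Prod.norm_def]
    exact norm_iteratedFDeriv_fderiv_apply_le (hw'.contDiffAt (hU.mem_nhds hp)) h1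

/-- **Nested partials are bounded by the joint derivative**: for a `C^{k+l}` field `w` on an open
set `U ∋ (t, x)`,
`‖Dᵏ_y (y ↦ (d/dτ)ˡ w(τ, y)|_{τ=t}) (x)‖ ≤ ‖D^{k+l} w (t, x)‖`. [folklore] -/
theorem norm_iteratedFDeriv_slice_iteratedDeriv_le (hU : IsOpen U) {k l : ℕ} {w : ℝ × E → F}
    (hw : ContDiffOn ℝ (k + l : ℕ) w U) {t : ℝ} {x : E} (hp : (t, x) ∈ U) :
    ‖iteratedFDeriv ℝ k (fun y => iteratedDeriv l (fun τ => w (τ, y)) t) x‖ ≤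
      ‖iteratedFDeriv ℝ (k + l) w (t, x)‖ := by
  set Wl := (fun (w : ℝ × E → F) (q : ℝ × E) => fderiv ℝ w q (1, 0))^[l] w with hWl
  have hWlk : ContDiffOn ℝ k Wl U := contDiffOn_iterate_fderiv_apply hU (1, 0) k l hw
  -- the nested partial agrees near `x` with the space slice of `∂ₜˡ w`
  have hev : (fun y => iteratedDeriv l (fun τ => w (τ, y)) t) =ᶠ[𝓝 x] fun y => Wl (t, y) := by
    have hopen : IsOpen {y : E | (t, y) ∈ U} := hU.preimage (continuous_const.prodMk continuous_id)
    filter_upwards [hopen.mem_nhds hp] with y hy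
    exact iteratedDeriv_slice_eq_iterate hU l (hw.of_le (by exact_mod_cast Nat.le_add_left l k)) hy
  rw [(hev.iteratedFDeriv ℝ k).eq_of_nhds]
  refine (ContinuousMultilinearMap.opNorm_le_bound (norm_nonneg _) fun H => ?_).trans
    (norm_iteratedFDeriv_iterate_le hU k l hw hp)
  rw [iteratedFDeriv_slice_apply hU hWlk hp H]
  refine (ContinuousMultilinearMap.le_opNorm _ _).trans_eq ?_
  congr 1
  refine Finset.prod_congr rfl fun i _ => ?_
  rw [Prod.norm_def, norm_zero]
  exact max_eq_right (norm_nonneg _)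

/-- **Nested partials are bounded by the joint derivative** (curried form): for `v : ℝ → E → F`
with `uncurry v` of class `C^{k+l}` on an open set `U ∋ (t, x)`,
`‖iteratedFDeriv ℝ k (y ↦ iteratedDeriv l (τ ↦ v τ y) t) x‖ ≤ ‖D^{k+l} (uncurry v) (t, x)‖`
(the quantities weighted in KNSS 2009, Prop. 4.1). [folklore] -/
theorem norm_iteratedFDeriv_iteratedDeriv_le_uncurry (hU : IsOpen U) {k l : ℕ} {v : ℝ → E → F}
    (hv : ContDiffOn ℝ (k + l : ℕ) (uncurry v) U) {t : ℝ} {x : E} (hp : (t, x) ∈ U) :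
    ‖iteratedFDeriv ℝ k (fun y => iteratedDeriv l (fun τ => v τ y) t) x‖ ≤
      ‖iteratedFDeriv ℝ (k + l) (uncurry v) (t, x)‖ :=
  norm_iteratedFDeriv_slice_iteratedDeriv_le hU hv hp

end Literature.Analysis.FunctionSpaces

end
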